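import Mathlib
import Literature.MathematicalPhysics.QuantumManyBody.BoseEinsteinCondensation
import HarnessLib

/-!
# Route `BECHardSphereReduction`, crux `HardSphereBEC` (stmt-AtomisticToContinuum-11885),
# line `registered` (`Lines/birth.lean`): the registered stub `stub_smallRatio_of`

Supports (does not close) stmt-AtomisticToContinuum-11885; stub `stub_smallRatio_of` (S6) of the
birth line, the BAIRE UNIFORMISATION OF THE DILATION RATIO.

Write `cn(N, L)` for the ground-state condensate number of `N` unit hard spheres in the Dirichlet
box of side `L` (`condensateNumber HS₁ N L`, `HS₁ = Set.indicator (Set.Iic 1) ⊤`).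

**Statement.** Assume
* (one-sided Baire, S5) countably many sets covering an open interval, each closed inside it under
  limits of its points from the left, cannot all miss every nondegenerate closed sub-interval;
* (left lower-semicontinuity, conclusion of S4) for all `N`, `x > 0`, `C`: if boxes `x' < x`
  arbitrarily close to `x` have `cn(N, x') ≤ C`, then `cn(N, x) ≤ C`;
* (per-ratio dilute box monotonicity, S2) for ratios `a` in some open interval
  `(lo, hi) ⊂ (0, 1)` there is a dilute guard `η₀(a) > 0` with `cn(N, L) ≤ cn(N, L/a)` whenever
  `N ≤ η₀(a) L³`.
Then there are `n : ℕ` and `a₀ > 0` such that `cn(N, aM) ≤ cn(N, M)` for every ratio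
`a ∈ (0, a₀]` and all `N, M` with `(n+1)·N < (aM)³` (UNIFORM small-ratio box monotonicity).

**Proof.** Put `A n := {a | ∀ N M, (n+1)N < (aM)³ → cn(N, aM) ≤ cn(N, M)}`.
* Cover: S2 at `a ∈ (lo, hi)` with `1/(n+1) < η₀(a)` gives `a ∈ A n` (box `L := aM`, `L/a = M`).
* Left closure: `A n` is closed from the left inside `(lo, hi)` by left lower-semicontinuity at
  `x := aM` (the guard forces `M > 0`; the strict guard persists for ratios `b < a` close to `a`
  by continuity of `b ↦ (bM)³`, and `b ∈ A n` gives `cn(N, bM) ≤ cn(N, M)` with `bM ↑ aM`).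
* Baire (S5) gives `[a₁, a₂] ⊆ A n` with `0 < lo ≤ a₁ < a₂ ≤ hi < 1`.
* Powers: by induction `cn(N, bᵏ⁺¹M) ≤ cn(N, M)` under `(n+1)N < (bᵏ⁺¹M)³` for `b ∈ [a₁, a₂]`
  (the boxes only grow along the chain `bᵏ⁺¹M, bᵏM, …, bM, M`, so the guard persists).
* Roots: with `p := log a₁ < q := log a₂ < 0` and `a₀ := exp (pq/(p-q))`, every `a ∈ (0, a₀]`
  is `bᵐ` for `m := ⌈log a / p⌉₊ ≥ 1` and `b := exp (log a / m) ∈ [a₁, a₂]`, because the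
  interval `[log a / p, log a / q]` has length `≥ 1` exactly when `log a ≤ pq/(p-q)`.

The whole argument is elementary real analysis about an ARBITRARY function `cn : ℕ → ℝ → ℝ≥0∞`;
the helper lemmas (`SmallRatio.*`) are stated in that generality and the registered stub is the
instance `cn := condensateNumber HS₁`.  Mathlib only.  [folklore]
-/

namespace Summit.AtomisticToContinuum.BoseEinsteinCondensation.Cruxes.HardSphereBEC.Birth

namespace SmallRatio

open Filter Topology

/-- A strict guard `c < x ^ 3` with `0 ≤ c` forces `0 < x`. [folklore] -/
theorem pos_of_lt_cube {c x : ℝ} (hc : 0 ≤ c) (h : c < x ^ 3) : 0 < x := by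
  by_contra hx
  push Not at hx
  have hx3 : x ^ 3 ≤ 0 := Odd.pow_nonpos (by decide : Odd 3) hx
  linarith

/-- The guard `(n+1)·N < (a·M)³` with `0 < a` forces `0 < M`. [folklore] -/
theorem pos_of_guard {n N : ℕ} {a M : ℝ} (ha : 0 < a)
    (hg : ((n : ℝ) + 1) * N < (a * M) ^ 3) : 0 < M :=
  pos_of_mul_pos_right (pos_of_lt_cube (by positivity) hg) ha.le

/-- **Cover.** Per-ratio dilute box monotonicity at one ratio `a > 0` with guard `η₀ > 0` puts
`a` in `A n := {a | ∀ N M, (n+1)N < (aM)³ → cn(N, aM) ≤ cn(N, M)}` as soon as `1/(n+1) < η₀`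
(box `L := aM`, `L/a = M`). [folklore] -/
theorem cover (cn : ℕ → ℝ → ENNReal) {a η₀ : ℝ} (ha : 0 < a) (hη₀ : 0 < η₀)
    (hper : ∀ (N : ℕ) (L : ℝ), (N : ℝ) ≤ η₀ * L ^ 3 → cn N L ≤ cn N (L / a)) :
    ∃ n : ℕ, ∀ (N : ℕ) (M : ℝ), ((n : ℝ) + 1) * N < (a * M) ^ 3 → cn N (a * M) ≤ cn N M := by
  obtain ⟨n, hn⟩ := exists_nat_one_div_lt hη₀
  refine ⟨n, fun N M hg => ?_⟩
  have hL3 : 0 < (a * M) ^ 3 := lt_of_le_of_lt (by positivity) hg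
  have hn1 : (0 : ℝ) < (n : ℝ) + 1 := by positivity
  have hN : (N : ℝ) ≤ η₀ * (a * M) ^ 3 := by
    have h1 : (N : ℝ) < (a * M) ^ 3 / ((n : ℝ) + 1) := by
      rw [lt_div_iff₀ hn1]; linarith
    have h2 : (a * M) ^ 3 / ((n : ℝ) + 1) ≤ η₀ * (a * M) ^ 3 := by
      rw [div_eq_mul_one_div, mul_comm]
      exact mul_le_mul_of_nonneg_right hn.le hL3.le
    linarith
  have h := hper N (a * M) hN
  rwa [mul_div_cancel_left₀ M ha.ne'] at h

/-- **Left closure.** If `L ↦ cn(N, L)` is left lower-semicontinuous (sublevel sets closed under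
approach from the left at every `x > 0`), then `A n` is closed under limits from the left at every
ratio `a > 0`: the guard forces `M > 0`, the strict guard `(n+1)N < (bM)³` persists for `b < a`
close to `a`, and `b ∈ A n` gives `cn(N, bM) ≤ cn(N, M)` with `bM ↑ aM`. [folklore] -/
theorem leftClosed (cn : ℕ → ℝ → ENNReal)
    (hLsc : ∀ (N : ℕ) (x : ℝ) (C : ENNReal), 0 < x →
      (∀ ε : ℝ, 0 < ε → ∃ x' : ℝ, x - ε < x' ∧ x' < x ∧ cn N x' ≤ C) → cn N x ≤ C)
    (n : ℕ) {a : ℝ} (ha : 0 < a)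
    (hleft : ∀ ε : ℝ, 0 < ε → ∃ b : ℝ, a - ε < b ∧ b < a ∧
      ∀ (N : ℕ) (M : ℝ), ((n : ℝ) + 1) * N < (b * M) ^ 3 → cn N (b * M) ≤ cn N M) :
    ∀ (N : ℕ) (M : ℝ), ((n : ℝ) + 1) * N < (a * M) ^ 3 → cn N (a * M) ≤ cn N M := by
  intro N M hg
  have hM : 0 < M := pos_of_guard ha hg
  refine hLsc N (a * M) (cn N M) (mul_pos ha hM) fun ε' hε' => ?_
  -- the strict guard persists for ratios `b` near `a`
  have hcont : ContinuousAt (fun b : ℝ => (b * M) ^ 3) a :=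
    ((continuous_id.mul continuous_const).pow 3).continuousAt
  have hev : ∀ᶠ b in 𝓝 a, ((n : ℝ) + 1) * N < (b * M) ^ 3 :=
    Filter.Tendsto.eventually_const_lt hg hcont
  obtain ⟨ε₁, hε₁, hguard⟩ := Metric.eventually_nhds_iff.1 hev
  obtain ⟨b, hab, hba, hbA⟩ := hleft (min ε₁ (ε' / M)) (lt_min hε₁ (div_pos hε' hM))
  have hab₁ : a - b < ε₁ := by
    have := min_le_left ε₁ (ε' / M); linarith
  have hab₂ : a - b < ε' / M := by
    have := min_le_right ε₁ (ε' / M); linarith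
  have hdist : dist b a < ε₁ := by
    rw [Real.dist_eq, abs_sub_comm, abs_of_pos (by linarith)]
    exact hab₁
  refine ⟨b * M, ?_, ?_, hbA N M (hguard hdist)⟩
  · have : (a - b) * M < ε' := by rwa [← lt_div_iff₀ hM]
    nlinarith
  · exact mul_lt_mul_of_pos_right hba hM

/-- **Powers.** If every ratio `b ∈ [a₁, a₂]` (`0 < a₁`, `a₂ ≤ 1`) lies in `A n`, then so does
every power `b^(k+1)`: along the chain `b^(k+1)M, b^k M, …, bM, M` the boxes only grow, so the
strict guard `(n+1)N < (·)³` persists from the smallest box to all the others. [folklore] -/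
theorem pow_chain (cn : ℕ → ℝ → ENNReal) (n : ℕ) {a₁ a₂ : ℝ} (h₁ : 0 < a₁) (h₂ : a₂ ≤ 1)
    (hA : ∀ b : ℝ, a₁ ≤ b → b ≤ a₂ →
      ∀ (N : ℕ) (M : ℝ), ((n : ℝ) + 1) * N < (b * M) ^ 3 → cn N (b * M) ≤ cn N M) :
    ∀ (k : ℕ) (b : ℝ), a₁ ≤ b → b ≤ a₂ →
      ∀ (N : ℕ) (M : ℝ), ((n : ℝ) + 1) * N < (b ^ (k + 1) * M) ^ 3 →
        cn N (b ^ (k + 1) * M) ≤ cn N M := by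
  intro k
  induction k with
  | zero =>
    intro b hb₁ hb₂ N M hg
    rw [zero_add, pow_one] at hg ⊢
    exact hA b hb₁ hb₂ N M hg
  | succ k ih =>
    intro b hb₁ hb₂ N M hg
    have hb : 0 < b := lt_of_lt_of_le h₁ hb₁
    have hb1 : b ≤ 1 := hb₂.trans h₂
    have hM : 0 < M := pos_of_guard (pow_pos hb _) hg
    have hsplit : b ^ (k + 1 + 1) * M = b ^ (k + 1) * (b * M) := by ring
    -- the smaller box `b^(k+2) M` versus the intermediate box `b M`
    have hstep₁ : cn N (b ^ (k + 1) * (b * M)) ≤ cn N (b * M) :=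
      ih b hb₁ hb₂ N (b * M) (by rwa [← hsplit])
    -- the guard persists for the larger box `b M`
    have hle : b ^ (k + 1 + 1) * M ≤ b * M :=
      mul_le_mul_of_nonneg_right (pow_le_of_le_one hb.le hb1 (Nat.succ_ne_zero _)) hM.le
    have hg' : ((n : ℝ) + 1) * N < (b * M) ^ 3 :=
      lt_of_lt_of_le hg (pow_le_pow_left₀ (by positivity) hle 3)
    have hstep₂ : cn N (b * M) ≤ cn N M := hA b hb₁ hb₂ N M hg'
    rw [hsplit]
    exact hstep₁.trans hstep₂

/-- **Roots.** For `0 < a₁ < a₂ < 1` put `p := log a₁ < q := log a₂ < 0` and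
`a₀ := exp (p q / (p - q))`.  Every `a ∈ (0, a₀]` is a positive power `b^(k+1)` of some
`b ∈ [a₁, a₂]`: with `ℓ := log a ≤ p q/(p - q) < 0` the interval `[ℓ/p, ℓ/q]` has length
`ℓ (p - q)/(p q) ≥ 1`, so it contains the positive integer `m := ⌈ℓ/p⌉₊`, and
`b := exp (ℓ/m)` has `log b = ℓ/m ∈ [p, q]` and `b^m = exp ℓ = a`. [folklore] -/
theorem exists_root {a₁ a₂ : ℝ} (h₁ : 0 < a₁) (h₁₂ : a₁ < a₂) (h₂ : a₂ < 1) {a : ℝ} (ha : 0 < a)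
    (hale : a ≤ Real.exp (Real.log a₁ * Real.log a₂ / (Real.log a₁ - Real.log a₂))) :
    ∃ (k : ℕ) (b : ℝ), a₁ ≤ b ∧ b ≤ a₂ ∧ b ^ (k + 1) = a := by
  set p := Real.log a₁ with hp_def
  set q := Real.log a₂ with hq_def
  have ha₂ : 0 < a₂ := h₁.trans h₁₂
  have hp : p < 0 := Real.log_neg h₁ (h₁₂.trans h₂)
  have hq : q < 0 := Real.log_neg ha₂ h₂
  have hpq : p < q := Real.log_lt_log h₁ h₁₂
  have hpq0 : 0 < p * q := mul_pos_of_neg_of_neg hp hq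
  have hpmq : p - q < 0 := sub_neg.2 hpq
  set ℓ := Real.log a with hℓ_def
  have hℓ : ℓ ≤ p * q / (p - q) := (Real.log_le_iff_le_exp ha).2 hale
  have hℓ' : p * q ≤ ℓ * (p - q) := (le_div_iff_of_neg hpmq).1 hℓ
  have hℓneg : ℓ < 0 := lt_of_le_of_lt hℓ (div_neg_of_pos_of_neg hpq0 hpmq)
  have ht : 0 < ℓ / p := div_pos_of_neg_of_neg hℓneg hp
  -- the exponent `m := ⌈ℓ/p⌉₊ ≥ 1`
  set m := ⌈ℓ / p⌉₊ with hm_def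
  have hm_pos : 0 < m := Nat.ceil_pos.2 ht
  have hm_posR : (0 : ℝ) < m := by exact_mod_cast hm_pos
  have hm_ge : ℓ / p ≤ m := Nat.le_ceil _
  have hm_lt : (m : ℝ) < ℓ / p + 1 := Nat.ceil_lt_add_one ht.le
  have hmp : (m : ℝ) * p ≤ ℓ := (div_le_iff_of_neg hp).1 hm_ge
  have hmq : ℓ ≤ (m : ℝ) * q := by
    have key : 1 ≤ ℓ / q - ℓ / p := by
      have e : ℓ / q - ℓ / p = ℓ * (p - q) / (p * q) := by
        rw [div_sub_div _ _ hq.ne hp.ne]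
        ring
      rw [e, one_le_div hpq0]
      exact hℓ'
    have hle : (m : ℝ) ≤ ℓ / q := by linarith
    exact (le_div_iff_of_neg hq).1 hle
  -- the root `b := exp (ℓ / m)`
  refine ⟨m - 1, Real.exp (ℓ / m), ?_, ?_, ?_⟩
  · calc a₁ = Real.exp p := (Real.exp_log h₁).symm
      _ ≤ Real.exp (ℓ / m) := Real.exp_le_exp.2 ((le_div_iff₀ hm_posR).2 (by linarith))
  · calc Real.exp (ℓ / m) ≤ Real.exp q :=
          Real.exp_le_exp.2 ((div_le_iff₀ hm_posR).2 (by linarith))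
      _ = a₂ := Real.exp_log ha₂
  · rw [Nat.sub_add_cancel hm_pos, ← Real.exp_nat_mul, mul_div_cancel₀ _ hm_posR.ne', hℓ_def,
      Real.exp_log ha]

/-- **Baire uniformisation for an arbitrary function `cn : ℕ → ℝ → ℝ≥0∞`.**  One-sided Baire on
an interval + left lower-semicontinuity of every `L ↦ cn(N, L)` + per-ratio box monotonicity on
an open interval of ratios `(lo, hi) ⊂ (0, 1)` ⟹ uniform small-ratio box monotonicity:
`∃ n a₀ > 0, ∀ a ∈ (0, a₀], ∀ N M, (n+1)N < (aM)³ → cn(N, aM) ≤ cn(N, M)`. [folklore] -/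
theorem uniform (cn : ℕ → ℝ → ENNReal)
    (hBaire : ∀ (A : ℕ → Set ℝ) (lo hi : ℝ), lo < hi →
      (∀ a : ℝ, lo < a → a < hi → ∃ n : ℕ, a ∈ A n) →
      (∀ (n : ℕ) (a : ℝ), lo < a → a < hi →
        (∀ ε : ℝ, 0 < ε → ∃ b : ℝ, a - ε < b ∧ b < a ∧ b ∈ A n) → a ∈ A n) →
      ∃ (n : ℕ) (a₁ a₂ : ℝ), lo ≤ a₁ ∧ a₁ < a₂ ∧ a₂ ≤ hi ∧ ∀ a : ℝ, a₁ ≤ a → a ≤ a₂ → a ∈ A n)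
    (hLsc : ∀ (N : ℕ) (x : ℝ) (C : ENNReal), 0 < x →
      (∀ ε : ℝ, 0 < ε → ∃ x' : ℝ, x - ε < x' ∧ x' < x ∧ cn N x' ≤ C) → cn N x ≤ C)
    (hPer : ∃ lo hi : ℝ, 0 < lo ∧ lo < hi ∧ hi < 1 ∧ ∀ a : ℝ, lo < a → a < hi →
      ∃ η₀ : ℝ, 0 < η₀ ∧ ∀ (N : ℕ) (L : ℝ), (N : ℝ) ≤ η₀ * L ^ 3 → cn N L ≤ cn N (L / a)) :
    ∃ (n : ℕ) (a₀ : ℝ), 0 < a₀ ∧ ∀ a : ℝ, 0 < a → a ≤ a₀ →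
      ∀ (N : ℕ) (M : ℝ), ((n : ℝ) + 1) * N < (a * M) ^ 3 → cn N (a * M) ≤ cn N M := by
  obtain ⟨lo, hi, hlo, hlohi, hhi1, hper⟩ := hPer
  -- Baire on `A n := {a | ∀ N M, (n+1)N < (aM)³ → cn N (aM) ≤ cn N M}`
  obtain ⟨n, a₁, a₂, hloa₁, h₁₂, ha₂hi, hA⟩ := hBaire
    (fun n => {a : ℝ | ∀ (N : ℕ) (M : ℝ), ((n : ℝ) + 1) * N < (a * M) ^ 3 → cn N (a * M) ≤ cn N M})
    lo hi hlohi
    (fun a hloa hahi => by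
      obtain ⟨η₀, hη₀, hmono⟩ := hper a hloa hahi
      exact cover cn (hlo.trans hloa) hη₀ hmono)
    (fun n a hloa _ hleft => leftClosed cn hLsc n (hlo.trans hloa) hleft)
  have h₁ : 0 < a₁ := lt_of_lt_of_le hlo hloa₁
  have h₂ : a₂ < 1 := lt_of_le_of_lt ha₂hi hhi1
  refine ⟨n, Real.exp (Real.log a₁ * Real.log a₂ / (Real.log a₁ - Real.log a₂)), Real.exp_pos _,
    fun a ha hale N M hg => ?_⟩
  obtain ⟨k, b, hb₁, hb₂, rfl⟩ := exists_root h₁ h₁₂ h₂ ha hale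
  exact pow_chain cn n h₁ h₂.le hA k b hb₁ hb₂ N M hg

end SmallRatio

/-- **S6 — BAIRE UNIFORMISATION OF THE DILATION RATIO.**  One-sided Baire on an interval (S5) +
left lower-semicontinuity of `L ↦ cn(HS₁, N, L)` (conclusion of S4) + per-ratio dilute box
monotonicity on an open interval of ratios (S2) ⟹ UNIFORM dilute box monotonicity for ALL small
ratios: there are `n` and `a₀ > 0` such that `cn(HS₁, N, aM) ≤ cn(HS₁, N, M)` for every
`a ∈ (0, a₀]` whenever `(n+1)·N < (aM)³`.  (With
`A n := {a | ∀ N M, (n+1)N < (aM)³ → cn(N, aM) ≤ cn(N, M)}`: S2 at `a ∈ (lo,hi)` with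
`1/(n+1) < η₀(a)` gives `a ∈ A n`; `A n` is closed from the left inside `(lo,hi)` by left-LSC at
`x := aM`; S5 gives `[a₁,a₂] ⊆ A n`, `lo ≤ a₁ < a₂ ≤ hi < 1`; by induction
`cn(N, bᵏ⁺¹M) ≤ cn(N, M)` under `(n+1)N < (bᵏ⁺¹M)³` for `b ∈ [a₁,a₂]`; finally every
`a ∈ (0, a₀]`, `a₀ := exp (log a₁ · log a₂ / (log a₁ - log a₂))`, is such a power.)  The instance
`cn := condensateNumber HS₁` of `SmallRatio.uniform`. [folklore] -/
theorem stub_smallRatio_of :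
    (∀ (A : ℕ → Set ℝ) (lo hi : ℝ), lo < hi → (∀ a : ℝ, lo < a → a < hi → ∃ n : ℕ, a ∈ A n) → (∀ (n : ℕ) (a : ℝ), lo < a → a < hi → (∀ ε : ℝ, 0 < ε → ∃ b : ℝ, a - ε < b ∧ b < a ∧ b ∈ A n) → a ∈ A n) → ∃ (n : ℕ) (a₁ a₂ : ℝ), lo ≤ a₁ ∧ a₁ < a₂ ∧ a₂ ≤ hi ∧ ∀ a : ℝ, a₁ ≤ a → a ≤ a₂ → a ∈ A n) →
    (∀ (N : ℕ) (x : ℝ) (C : ENNReal), 0 < x → (∀ ε : ℝ, 0 < ε → ∃ x' : ℝ, x - ε < x' ∧ x' < x ∧ Literature.MathematicalPhysics.QuantumManyBody.BoseGas.condensateNumber (Set.indicator (Set.Iic 1) (fun _ : ℝ => (⊤ : ENNReal))) N x' ≤ C) → Literature.MathematicalPhysics.QuantumManyBody.BoseGas.condensateNumber (Set.indicator (Set.Iic 1) (fun _ : ℝ => (⊤ : ENNReal))) N x ≤ C) →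
    (∃ lo hi : ℝ, 0 < lo ∧ lo < hi ∧ hi < 1 ∧ ∀ a : ℝ, lo < a → a < hi → ∃ η₀ : ℝ, 0 < η₀ ∧ ∀ (N : ℕ) (L : ℝ), (N : ℝ) ≤ η₀ * L ^ 3 → Literature.MathematicalPhysics.QuantumManyBody.BoseGas.condensateNumber (Set.indicator (Set.Iic 1) (fun _ : ℝ => (⊤ : ENNReal))) N L ≤ Literature.MathematicalPhysics.QuantumManyBody.BoseGas.condensateNumber (Set.indicator (Set.Iic 1) (fun _ : ℝ => (⊤ : ENNReal))) N (L / a)) →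
    ∃ (n : ℕ) (a₀ : ℝ), 0 < a₀ ∧ ∀ a : ℝ, 0 < a → a ≤ a₀ → ∀ (N : ℕ) (M : ℝ), ((n : ℝ) + 1) * N < (a * M) ^ 3 → Literature.MathematicalPhysics.QuantumManyBody.BoseGas.condensateNumber (Set.indicator (Set.Iic 1) (fun _ : ℝ => (⊤ : ENNReal))) N (a * M) ≤ Literature.MathematicalPhysics.QuantumManyBody.BoseGas.condensateNumber (Set.indicator (Set.Iic 1) (fun _ : ℝ => (⊤ : ENNReal))) N M :=
  SmallRatio.uniform
    (Literature.MathematicalPhysics.QuantumManyBody.BoseGas.condensateNumber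
      (Set.indicator (Set.Iic 1) (fun _ : ℝ => (⊤ : ENNReal))))


end Summit.AtomisticToContinuum.BoseEinsteinCondensation.Cruxes.HardSphereBEC.Birth
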